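import Mathlib
import Summits.PneNP.PneNP.Theorems.ClusUniversalCertificateCoordBookQ
import Summits.PneNP.PneNP.Theorems.ClusUniversalCertificateCoordGauge

/-!
# Route ClusUniversalCertificate, crux `UniversalCertAll` — path `coord`: the FLAT-COVER STEP (`fcStepQ`)

Support file for `stmt-PneNP-19683` (cell pnp-ideate, route `ClusUniversalCertificate`, rung F-N1; path `coord` of pnp-ideate-p1, skeleton v13
sha16 c4824afb; ask H1 of p1 g7, STATUS 11:52Z; objects of record `…CoordDefs.lean` p516754 / `…CoordBlkDefs.lean` p519312 / `…CoordBookQ.lean`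
p527506, namespace `…Theorems.ClusCoord`).  The strongest FLAT-BASED sufficient condition for the (fractional) block step:

**Flat cover.**  A list `C` of pairs `(A, c_A)` — affine flats `A` all of whose points lie in `Y`, with multiplicities `c_A : ℕ` — covering
every point of `Y` exactly `q` times (`Σ_{A ∋ y} c_A = q`).  For the block `k` (deleted along `π = delBlk`, `kemb` data `(M', h)`) put
`s_A := finrank (ker (π | A.direction))` (`= dim (A.direction ∩ V_k)`).  The fibres of `A ∩ Y = A` over `π(A)` are cosets of that kernel, so the
members `π(A)`, each repeated `c_A · 2^{s_A}` times (translates `0`), form a q-FOLD BLOCK LAYER FAMILY (`isBLayerFamilyQ_coverFamily`), every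
member satisfies `dsum M' (π A) ≥ |π A|·(finrank A.direction − s_A)` (rank–nullity, `dsum_member_ge`), and the translate credit of the family
vanishes (`Σ_members Z_j = q·Z_j(Y)` for `j ≠ k`).  Hence the FLAT-COVER INEQUALITY

  `Σ_A c_A · ( Σ_{y ∈ A} (M − acodim_Y y) − |A|·(finrank A.direction − s_A) − |A|·(bsize k − 1) − 2^{bsize k}·Z_k(A) ) ≤ 0`

implies `∃ L, IsBLayerFamilyQ blk Y k M' h q (L.map Prod.fst) ∧ BLayerIneqTQ M n blk Y k M' h q L` (`fcStepQ`), which the landed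
`ClusCoord.cBookBlkTQ` turns into the mixed certificate of `Y` from the members' certificates.
FRONTIER rung F-N1; a SUFFICIENT condition — the conjecture (`stub_peelZeroRare5`) and the crux are OPEN; nothing here bears on P vs NP.
-/

set_option linter.dupNamespace false -- `Summit.PneNP.PneNP.…`: summit = sub-problem name (D-0017 single-conjunct layout)

namespace Summit.PneNP.PneNP.Theorems.ClusCoordFlatCover

open Finset
open Summit.PneNP.PneNP.Theorems.ClusCoord (acodim dsum bsize zcount UCMix kemb IsBLayerFamilyQ BLayerIneqTQ)
open Summit.PneNP.PneNP.Theorems.ClusCoordBook (list_sum_map_finset_sum list_sum_map_le)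
open Summit.PneNP.PneNP.Theorems.ClusCoordBookBlk (blockZero_kemb_iff_of_ne)
open Summit.PneNP.PneNP.Theorems.ClusCoordBookQ (list_sum_card_filter_eq_mul)
open Summit.PneNP.PneNP.Theorems.ClusCoordGauge (delBlk delBlk_apply)

variable {M M' n : ℕ}

/-! ## The data of a flat cover -/

open scoped Classical in
/-- The points of the flat `A` inside `Y` (all of `A`'s points when `A ⊆ Y`). -/
noncomputable def pts (Y : Finset (Fin M → ZMod 2)) (A : AffineSubspace (ZMod 2) (Fin M → ZMod 2)) : Finset (Fin M → ZMod 2) :=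
  Y.filter fun y => y ∈ A

/-- The member of the flat `A`: its points with block `k` deleted. -/
noncomputable def memb (blk : Fin M → Fin n) (Y : Finset (Fin M → ZMod 2)) (k : Fin n) (M' : ℕ)
    (h : (univ.filter fun i => blk i ≠ k).card = M') (A : AffineSubspace (ZMod 2) (Fin M → ZMod 2)) :
    Finset (Fin M' → ZMod 2) :=
  (pts Y A).image (delBlk blk k M' h)

/-- `s_A`: the dimension of the kernel of the block deletion on the direction of `A` (`= dim (A.direction ∩ V_k)`). -/
noncomputable def sdim (blk : Fin M → Fin n) (k : Fin n) (M' : ℕ) (h : (univ.filter fun i => blk i ≠ k).card = M')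
    (A : AffineSubspace (ZMod 2) (Fin M → ZMod 2)) : ℕ :=
  Module.finrank (ZMod 2) (LinearMap.ker ((delBlk blk k M' h).domRestrict A.direction))

/-- The multiplicity of the member of `(A, c_A)`: `c_A · 2^{s_A}`. -/
noncomputable def mult (blk : Fin M → Fin n) (k : Fin n) (M' : ℕ) (h : (univ.filter fun i => blk i ≠ k).card = M')
    (p : AffineSubspace (ZMod 2) (Fin M → ZMod 2) × ℕ) : ℕ :=
  p.2 * 2 ^ sdim blk k M' h p.1

/-- The COVER FAMILY: each member `π(A)` repeated `c_A · 2^{s_A}` times, with translate `0`. -/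
noncomputable def coverFamily (blk : Fin M → Fin n) (Y : Finset (Fin M → ZMod 2)) (k : Fin n) (M' : ℕ)
    (h : (univ.filter fun i => blk i ≠ k).card = M') (C : List (AffineSubspace (ZMod 2) (Fin M → ZMod 2) × ℕ)) :
    List (Finset (Fin M' → ZMod 2) × (Fin M' → ZMod 2)) :=
  C.flatMap fun p => List.replicate (mult blk k M' h p) (memb blk Y k M' h p.1, 0)

/-! ## List plumbing for the cover family -/

/-- Counting the members of the cover family containing a point `x`. -/
theorem length_filter_fst_coverFamily (blk : Fin M → Fin n) (Y : Finset (Fin M → ZMod 2)) (k : Fin n) (M' : ℕ)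
    (h : (univ.filter fun i => blk i ≠ k).card = M') (C : List (AffineSubspace (ZMod 2) (Fin M → ZMod 2) × ℕ))
    (x : Fin M' → ZMod 2) :
    (((coverFamily blk Y k M' h C).map Prod.fst).filter fun S => x ∈ S).length =
      (C.map fun p => if x ∈ memb blk Y k M' h p.1 then mult blk k M' h p else 0).sum := by
  induction C with
  | nil => simp [coverFamily]
  | cons p C ih =>
    have hcons : coverFamily blk Y k M' h (p :: C) =
        List.replicate (mult blk k M' h p) (memb blk Y k M' h p.1, (0 : Fin M' → ZMod 2)) ++ coverFamily blk Y k M' h C := by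
      simp [coverFamily]
    rw [hcons, List.map_append, List.filter_append, List.length_append, List.map_cons, List.sum_cons, List.map_replicate,
      ih]
    congr 1
    by_cases hx : x ∈ memb blk Y k M' h p.1
    · rw [if_pos hx, List.filter_eq_self.mpr, List.length_replicate]
      intro S hS
      rw [List.eq_of_mem_replicate hS]
      simpa using hx
    · rw [if_neg hx, List.length_eq_zero_iff, List.filter_eq_nil_iff]
      intro S hS
      rw [List.eq_of_mem_replicate hS]
      simpa using hx

/-- Summing a function over the cover family. -/
theorem sum_map_coverFamily (blk : Fin M → Fin n) (Y : Finset (Fin M → ZMod 2)) (k : Fin n) (M' : ℕ)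
    (h : (univ.filter fun i => blk i ≠ k).card = M') (C : List (AffineSubspace (ZMod 2) (Fin M → ZMod 2) × ℕ))
    (g : Finset (Fin M' → ZMod 2) × (Fin M' → ZMod 2) → ℤ) :
    ((coverFamily blk Y k M' h C).map g).sum =
      (C.map fun p => (mult blk k M' h p : ℤ) * g (memb blk Y k M' h p.1, 0)).sum := by
  induction C with
  | nil => simp [coverFamily]
  | cons p C ih =>
    have hcons : coverFamily blk Y k M' h (p :: C) =
        List.replicate (mult blk k M' h p) (memb blk Y k M' h p.1, (0 : Fin M' → ZMod 2)) ++ coverFamily blk Y k M' h C := by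
      simp [coverFamily]
    rw [hcons, List.map_append, List.sum_append, List.map_cons, List.sum_cons, List.map_replicate, List.sum_replicate,
      nsmul_eq_mul, ih]

/-! ## Fibres of a flat over its projection -/

open scoped Classical in
/-- The fibre of `pts Y A` over the projection of one of its points is a coset of `ker (π | A.direction)`: it has `2^{s_A}` points. -/
theorem card_fibre_pts (blk : Fin M → Fin n) (Y : Finset (Fin M → ZMod 2)) (k : Fin n) (M' : ℕ)
    (h : (univ.filter fun i => blk i ≠ k).card = M') (A : AffineSubspace (ZMod 2) (Fin M → ZMod 2))
    (hAY : ∀ z ∈ A, z ∈ Y) (y₀ : Fin M → ZMod 2) (hy₀ : y₀ ∈ A) :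
    ((pts Y A).filter fun y => delBlk blk k M' h y = delBlk blk k M' h y₀).card = 2 ^ sdim blk k M' h A := by
  set π := delBlk blk k M' h with hπ
  set K := LinearMap.ker (π.domRestrict A.direction) with hK
  -- the fibre is the translate by `y₀` of `K`
  let f : K ↪ (Fin M → ZMod 2) :=
    ⟨fun d => (d.1.1 : Fin M → ZMod 2) + y₀, fun a b hab => Subtype.ext (Subtype.ext (add_right_cancel hab))⟩
  have hset : ((pts Y A).filter fun y => π y = π y₀) = (univ : Finset K).map f := by
    ext y
    rw [Finset.mem_map, Finset.mem_filter]
    unfold pts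
    rw [Finset.mem_filter]
    constructor
    · rintro ⟨⟨-, hyA⟩, hyx⟩
      have hd : y -ᵥ y₀ ∈ A.direction := AffineSubspace.vsub_mem_direction hyA hy₀
      have hdk : (⟨y -ᵥ y₀, hd⟩ : A.direction) ∈ K := by
        rw [hK, LinearMap.mem_ker, LinearMap.domRestrict_apply]
        change π (y -ᵥ y₀) = 0
        rw [vsub_eq_sub, map_sub, hyx, sub_self]
      refine ⟨⟨⟨y -ᵥ y₀, hd⟩, hdk⟩, Finset.mem_univ _, ?_⟩
      change (y -ᵥ y₀) + y₀ = y
      rw [vsub_eq_sub, sub_add_cancel]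
    · rintro ⟨d, -, rfl⟩
      have hdA : (d.1.1 : Fin M → ZMod 2) +ᵥ y₀ ∈ A := AffineSubspace.vadd_mem_of_mem_direction d.1.2 hy₀
      have hd0 : π (d.1.1 : Fin M → ZMod 2) = 0 := by
        have h2 : d.1 ∈ LinearMap.ker (π.domRestrict A.direction) := d.2
        rw [LinearMap.mem_ker, LinearMap.domRestrict_apply] at h2
        exact h2
      refine ⟨⟨hAY _ hdA, hdA⟩, ?_⟩
      change π (d.1.1 + y₀) = π y₀
      rw [map_add, hd0, zero_add]
  rw [hset, Finset.card_map, Finset.card_univ]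
  unfold sdim
  rw [Module.card_eq_pow_finrank (K := ZMod 2), ZMod.card]

open scoped Classical in
/-- Fibrewise counting: for every property `P` one block down,
`#{y ∈ pts Y A : P (π y)} = 2^{s_A} · #{x ∈ memb : P x}`. -/
theorem card_filter_pts_eq (blk : Fin M → Fin n) (Y : Finset (Fin M → ZMod 2)) (k : Fin n) (M' : ℕ)
    (h : (univ.filter fun i => blk i ≠ k).card = M') (A : AffineSubspace (ZMod 2) (Fin M → ZMod 2))
    (hAY : ∀ z ∈ A, z ∈ Y) (P : (Fin M' → ZMod 2) → Prop) [DecidablePred P] :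
    ((pts Y A).filter fun y => P (delBlk blk k M' h y)).card = 2 ^ sdim blk k M' h A * ((memb blk Y k M' h A).filter P).card := by
  rw [Finset.card_eq_sum_card_fiberwise (f := delBlk blk k M' h) (s := (pts Y A).filter fun y => P (delBlk blk k M' h y))
    (t := (memb blk Y k M' h A).filter P) (fun y hy =>
      Finset.mem_filter.2 ⟨Finset.mem_image_of_mem _ (Finset.mem_filter.1 hy).1, (Finset.mem_filter.1 hy).2⟩)]
  rw [Finset.card_eq_sum_ones ((memb blk Y k M' h A).filter P), Finset.mul_sum, mul_one]
  refine Finset.sum_congr rfl fun x hx => ?_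
  obtain ⟨hxm, hPx⟩ := Finset.mem_filter.1 hx
  obtain ⟨y₀, hy₀, rfl⟩ := Finset.mem_image.1 hxm
  have hy₀A : y₀ ∈ A := (Finset.mem_filter.1 hy₀).2
  rw [← card_fibre_pts blk Y k M' h A hAY y₀ hy₀A]
  congr 1
  ext y
  simp only [Finset.mem_filter]
  constructor
  · rintro ⟨⟨hy, -⟩, hyx⟩; exact ⟨hy, hyx⟩
  · rintro ⟨hy, hyx⟩; exact ⟨⟨hy, hyx ▸ hPx⟩, hyx⟩

/-- `|pts Y A| = 2^{s_A} · |memb|`. -/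
theorem card_pts_eq (blk : Fin M → Fin n) (Y : Finset (Fin M → ZMod 2)) (k : Fin n) (M' : ℕ)
    (h : (univ.filter fun i => blk i ≠ k).card = M') (A : AffineSubspace (ZMod 2) (Fin M → ZMod 2))
    (hAY : ∀ z ∈ A, z ∈ Y) : (pts Y A).card = 2 ^ sdim blk k M' h A * (memb blk Y k M' h A).card := by
  simpa using card_filter_pts_eq blk Y k M' h A hAY (fun _ => True)

/-- `Z_j(pts Y A) = 2^{s_A} · Z_j(memb)` for a block `j ≠ k`. -/
theorem zcount_pts_eq (blk : Fin M → Fin n) (Y : Finset (Fin M → ZMod 2)) (k : Fin n) (M' : ℕ)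
    (h : (univ.filter fun i => blk i ≠ k).card = M') (A : AffineSubspace (ZMod 2) (Fin M → ZMod 2))
    (hAY : ∀ z ∈ A, z ∈ Y) (j : Fin n) (hj : j ≠ k) :
    zcount blk j (pts Y A) = 2 ^ sdim blk k M' h A * zcount (blk ∘ kemb blk k M' h) j (memb blk Y k M' h A) := by
  unfold zcount
  rw [← card_filter_pts_eq blk Y k M' h A hAY (fun x => ∀ l : Fin M', (blk ∘ kemb blk k M' h) l = j → x l = 0)]
  congr 1
  apply Finset.filter_congr
  intro y _
  rw [delBlk_apply]
  exact (blockZero_kemb_iff_of_ne blk k h j hj y).symm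

/-! ## The member of a flat is flat-rich -/

open scoped Classical in
/-- `dsum M' (memb A) ≥ |memb A| · (finrank A.direction − s_A)`: the member contains the projected flat, of dimension
`finrank A.direction − s_A` by rank–nullity. -/
theorem dsum_member_ge (blk : Fin M → Fin n) (Y : Finset (Fin M → ZMod 2)) (k : Fin n) (M' : ℕ)
    (h : (univ.filter fun i => blk i ≠ k).card = M') (A : AffineSubspace (ZMod 2) (Fin M → ZMod 2))
    (hAY : ∀ z ∈ A, z ∈ Y) :
    ((memb blk Y k M' h A).card : ℤ) * ((Module.finrank (ZMod 2) A.direction : ℤ) - (sdim blk k M' h A : ℤ)) ≤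
      dsum M' (memb blk Y k M' h A) := by
  set π := delBlk blk k M' h with hπ
  -- rank–nullity on `A.direction`
  have hrn : Module.finrank (ZMod 2) (A.direction.map π) + sdim blk k M' h A = Module.finrank (ZMod 2) A.direction := by
    have := LinearMap.finrank_range_add_finrank_ker (π.domRestrict A.direction)
    rw [LinearMap.range_domRestrict] at this
    exact this
  have hle : Module.finrank (ZMod 2) (A.direction.map π) ≤ M' := by
    have := Submodule.finrank_le (A.direction.map π)
    rw [Module.finrank_fintype_fun_eq_card, Fintype.card_fin] at this
    exact this
  -- every point of the member has `acodim ≤ M' − finrank (A.direction.map π)`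
  have hpt : ∀ x ∈ memb blk Y k M' h A,
      acodim M' (memb blk Y k M' h A) x ≤ M' - Module.finrank (ZMod 2) (A.direction.map π) := by
    intro x hx
    obtain ⟨y₀, hy₀, rfl⟩ := Finset.mem_image.1 hx
    have hy₀A : y₀ ∈ A := (Finset.mem_filter.1 hy₀).2
    unfold acodim
    apply Nat.sInf_le
    refine ⟨A.map π.toAffineMap, ⟨y₀, hy₀A, rfl⟩, ?_, ?_⟩
    · rintro z ⟨w, hw, rfl⟩
      exact Finset.mem_image_of_mem _ (Finset.mem_filter.2 ⟨hAY w hw, hw⟩)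
    · rw [AffineSubspace.map_direction, LinearMap.toAffineMap_linear]
      omega
  unfold dsum
  have hsum : ∑ x ∈ memb blk Y k M' h A, ((Module.finrank (ZMod 2) A.direction : ℤ) - (sdim blk k M' h A : ℤ)) ≤
      ∑ x ∈ memb blk Y k M' h A, ((M' : ℤ) - (acodim M' (memb blk Y k M' h A) x : ℤ)) := by
    refine Finset.sum_le_sum fun x hx => ?_
    have h1 := hpt x hx
    have h1' : (acodim M' (memb blk Y k M' h A) x : ℤ) ≤ (M' : ℤ) - (Module.finrank (ZMod 2) (A.direction.map π) : ℤ) := by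
      have : ((M' - Module.finrank (ZMod 2) (A.direction.map π) : ℕ) : ℤ) =
          (M' : ℤ) - (Module.finrank (ZMod 2) (A.direction.map π) : ℤ) := by
        rw [Nat.cast_sub hle]
      rw [← this]
      exact_mod_cast h1
    have hrn' : (Module.finrank (ZMod 2) (A.direction.map π) : ℤ) + (sdim blk k M' h A : ℤ) =
        (Module.finrank (ZMod 2) A.direction : ℤ) := by exact_mod_cast hrn
    linarith
  rw [Finset.sum_const, nsmul_eq_mul] at hsum
  exact hsum

/-! ## Double counting through the cover -/

open scoped Classical in
/-- For a cover of multiplicity `q`: `Σ_A c_A · Σ_{y ∈ pts Y A} g y = q · Σ_{y ∈ Y} g y`. -/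
theorem cover_sum (Y : Finset (Fin M → ZMod 2)) (C : List (AffineSubspace (ZMod 2) (Fin M → ZMod 2) × ℕ)) (q : ℕ)
    (hcov : ∀ y ∈ Y, (C.map fun p => if y ∈ p.1 then (p.2 : ℤ) else 0).sum = q) (g : (Fin M → ZMod 2) → ℤ) :
    (C.map fun p => (p.2 : ℤ) * ∑ y ∈ pts Y p.1, g y).sum = (q : ℤ) * ∑ y ∈ Y, g y := by
  have hp : ∀ p : AffineSubspace (ZMod 2) (Fin M → ZMod 2) × ℕ,
      (p.2 : ℤ) * ∑ y ∈ pts Y p.1, g y = ∑ y ∈ Y, (if y ∈ p.1 then (p.2 : ℤ) else 0) * g y := by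
    intro p
    unfold pts
    rw [Finset.sum_filter, Finset.mul_sum]
    refine Finset.sum_congr rfl fun y _ => ?_
    split_ifs <;> simp
  simp_rw [hp]
  rw [list_sum_map_finset_sum, Finset.mul_sum]
  refine Finset.sum_congr rfl fun y hy => ?_
  rw [List.sum_map_mul_right, hcov y hy]

/-! ## The flat-cover step -/

open scoped Classical in
/-- **The cover family is a q-fold block layer family.** -/
theorem isBLayerFamilyQ_coverFamily (blk : Fin M → Fin n) (Y : Finset (Fin M → ZMod 2)) (k : Fin n) (M' : ℕ)
    (h : (univ.filter fun i => blk i ≠ k).card = M') (q : ℕ) (C : List (AffineSubspace (ZMod 2) (Fin M → ZMod 2) × ℕ))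
    (hCY : ∀ p ∈ C, ∀ z ∈ p.1, z ∈ Y) (hcov : ∀ y ∈ Y, (C.map fun p => if y ∈ p.1 then (p.2 : ℤ) else 0).sum = q) :
    IsBLayerFamilyQ blk Y k M' h q ((coverFamily blk Y k M' h C).map Prod.fst) := by
  intro x
  rw [length_filter_fst_coverFamily]
  -- the indicator of the fibre over `x`, summed over `pts Y A`, is `[x ∈ memb A] · 2^{s_A}`
  have hfib : ∀ p ∈ C, ∑ y ∈ pts Y p.1, (if delBlk blk k M' h y = x then (1 : ℤ) else 0) =
      if x ∈ memb blk Y k M' h p.1 then ((2 ^ sdim blk k M' h p.1 : ℕ) : ℤ) else 0 := by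
    intro p hp
    rw [Finset.sum_boole]
    split_ifs with hx
    · obtain ⟨y₀, hy₀, hy₀x⟩ := Finset.mem_image.1 hx
      have hy₀A : y₀ ∈ p.1 := (Finset.mem_filter.1 hy₀).2
      rw [← hy₀x, card_fibre_pts blk Y k M' h p.1 (hCY p hp) y₀ hy₀A]
    · have : ((pts Y p.1).filter fun y => delBlk blk k M' h y = x) = ∅ := by
        rw [Finset.filter_eq_empty_iff]
        intro y hy hyx
        exact hx (hyx ▸ Finset.mem_image_of_mem _ hy)
      rw [this, Finset.card_empty, Nat.cast_zero]
  have hterm : ∀ p ∈ C, ((if x ∈ memb blk Y k M' h p.1 then mult blk k M' h p else 0 : ℕ) : ℤ) =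
      (p.2 : ℤ) * ∑ y ∈ pts Y p.1, (if delBlk blk k M' h y = x then (1 : ℤ) else 0) := by
    intro p hp
    rw [hfib p hp]
    unfold mult
    split_ifs <;> push_cast <;> ring
  have hℤ : ((C.map fun p => if x ∈ memb blk Y k M' h p.1 then mult blk k M' h p else 0).sum : ℤ) =
      (q : ℤ) * ((Y.filter fun y => (fun j => y (kemb blk k M' h j)) = x).card : ℤ) := by
    rw [Nat.cast_list_sum, List.map_map]
    have : (C.map (Nat.cast ∘ fun p => if x ∈ memb blk Y k M' h p.1 then mult blk k M' h p else 0)).sum =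
        (C.map fun p => (p.2 : ℤ) * ∑ y ∈ pts Y p.1, (if delBlk blk k M' h y = x then (1 : ℤ) else 0)).sum := by
      congr 1
      exact List.map_congr_left fun p hp => hterm p hp
    rw [this, cover_sum Y C q hcov, Finset.sum_boole]
    rfl
  exact_mod_cast hℤ

open scoped Classical in
/-- **The FLAT-COVER STEP (`fcStepQ`)**: a flat cover of `Y` of multiplicity `q` satisfying the flat-cover inequality yields a q-fold
block layer family (members `π(A)` with multiplicity `c_A·2^{s_A}`, translates `0`) satisfying the q-fold translate-credited block layer
inequality — to be fed to `ClusCoord.cBookBlkTQ`. -/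
theorem fcStepQ (blk : Fin M → Fin n) (Y : Finset (Fin M → ZMod 2)) (k : Fin n) (M' : ℕ)
    (h : (univ.filter fun i => blk i ≠ k).card = M') (q : ℕ) (C : List (AffineSubspace (ZMod 2) (Fin M → ZMod 2) × ℕ))
    (hCY : ∀ p ∈ C, ∀ z ∈ p.1, z ∈ Y) (hcov : ∀ y ∈ Y, (C.map fun p => if y ∈ p.1 then (p.2 : ℤ) else 0).sum = q)
    (hFC : (C.map fun p => (p.2 : ℤ) * ((∑ y ∈ pts Y p.1, ((M : ℤ) - (acodim M Y y : ℤ))) -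
        ((pts Y p.1).card : ℤ) * ((Module.finrank (ZMod 2) p.1.direction : ℤ) - (sdim blk k M' h p.1 : ℤ)) -
        ((pts Y p.1).card : ℤ) * ((bsize blk k : ℤ) - 1) -
        (2 : ℤ) ^ (bsize blk k) * (zcount blk k (pts Y p.1) : ℤ))).sum ≤ 0) :
    ∃ L : List (Finset (Fin M' → ZMod 2) × (Fin M' → ZMod 2)),
      IsBLayerFamilyQ blk Y k M' h q (L.map Prod.fst) ∧ BLayerIneqTQ M n blk Y k M' h q L := by
  have hfam := isBLayerFamilyQ_coverFamily blk Y k M' h q C hCY hcov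
  refine ⟨coverFamily blk Y k M' h C, hfam, ?_⟩
  unfold BLayerIneqTQ
  set blk' := blk ∘ kemb blk k M' h with hblk'
  -- the translate credit vanishes: `Σ_members Z_j(S + 0) = q · Z_j(Y)` for `j ≠ k`
  have hcredit : ∀ j ∈ univ.erase k,
      ((coverFamily blk Y k M' h C).map fun p => (zcount blk' j (p.1.image fun x => x + p.2) : ℤ)).sum =
        (q : ℤ) * (zcount blk j Y : ℤ) := by
    intro j hj
    have hj' : j ≠ k := Finset.ne_of_mem_erase hj
    have hid : ∀ p ∈ coverFamily blk Y k M' h C, (zcount blk' j (p.1.image fun x => x + p.2) : ℤ) = (zcount blk' j p.1 : ℤ) := by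
      intro p hp
      unfold coverFamily at hp
      rw [List.mem_flatMap] at hp
      obtain ⟨a, -, ha⟩ := hp
      rw [List.eq_of_mem_replicate ha]
      simp only [add_zero, Finset.image_id']
    rw [List.map_congr_left hid]
    have h2 : ((coverFamily blk Y k M' h C).map fun p => (zcount blk' j p.1 : ℤ)).sum =
        (((coverFamily blk Y k M' h C).map Prod.fst).map fun S => (zcount blk' j S : ℤ)).sum := by
      rw [List.map_map]; rfl
    rw [h2]
    unfold zcount
    rw [list_sum_card_filter_eq_mul (fun y : Fin M → ZMod 2 => fun l' => y (kemb blk k M' h l')) Y q _ hfam]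
    have hfilt : (Y.filter fun y => ∀ l : Fin M', blk' l = j → (fun l' => y (kemb blk k M' h l')) l = 0) =
        Y.filter fun y => ∀ i, blk i = j → y i = 0 :=
      Finset.filter_congr fun y _ => blockZero_kemb_iff_of_ne blk k h j hj' y
    rw [hfilt]
  have hcredit0 : ∑ j ∈ univ.erase k, (2 : ℤ) ^ (bsize blk j) *
      ((q : ℤ) * (zcount blk j Y : ℤ) -
        ((coverFamily blk Y k M' h C).map fun p => (zcount blk' j (p.1.image fun x => x + p.2) : ℤ)).sum) = 0 := by
    refine Finset.sum_eq_zero fun j hj => ?_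
    rw [hcredit j hj, sub_self, mul_zero]
  rw [hcredit0, add_zero]
  -- the members' dimensions
  have hmem : (C.map fun p => (p.2 : ℤ) * (((pts Y p.1).card : ℤ) *
      ((Module.finrank (ZMod 2) p.1.direction : ℤ) - (sdim blk k M' h p.1 : ℤ)))).sum ≤
      ((coverFamily blk Y k M' h C).map fun p => dsum M' p.1).sum := by
    rw [sum_map_coverFamily]
    apply list_sum_map_le
    intro p hp
    have h1 := dsum_member_ge blk Y k M' h p.1 (hCY p hp)
    have h2 : ((pts Y p.1).card : ℤ) = (2 : ℤ) ^ sdim blk k M' h p.1 * ((memb blk Y k M' h p.1).card : ℤ) := by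
      exact_mod_cast card_pts_eq blk Y k M' h p.1 (hCY p hp)
    unfold mult
    push_cast
    rw [h2]
    have h3 : (0 : ℤ) ≤ (p.2 : ℤ) * (2 : ℤ) ^ sdim blk k M' h p.1 := by positivity
    nlinarith
  -- per flat: the FC summand is `c_A · Σ_{y ∈ pts} G y − c_A · |pts|·(dim − s)` with the point weight `G`
  set G : (Fin M → ZMod 2) → ℤ := fun y =>
    ((M : ℤ) - (acodim M Y y : ℤ)) - ((bsize blk k : ℤ) - 1) -
      (2 : ℤ) ^ (bsize blk k) * (if (∀ i, blk i = k → y i = 0) then (1 : ℤ) else 0) with hG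
  have hsumG : ∀ T : Finset (Fin M → ZMod 2), ∑ y ∈ T, G y =
      (∑ y ∈ T, ((M : ℤ) - (acodim M Y y : ℤ))) - (T.card : ℤ) * ((bsize blk k : ℤ) - 1) -
        (2 : ℤ) ^ (bsize blk k) * (zcount blk k T : ℤ) := by
    intro T
    unfold zcount
    rw [hG]
    simp only []
    rw [Finset.sum_sub_distrib, Finset.sum_sub_distrib, Finset.sum_const, nsmul_eq_mul, ← Finset.mul_sum, Finset.sum_boole]
  have hper : ∀ p ∈ C, (p.2 : ℤ) * ((∑ y ∈ pts Y p.1, ((M : ℤ) - (acodim M Y y : ℤ))) -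
        ((pts Y p.1).card : ℤ) * ((Module.finrank (ZMod 2) p.1.direction : ℤ) - (sdim blk k M' h p.1 : ℤ)) -
        ((pts Y p.1).card : ℤ) * ((bsize blk k : ℤ) - 1) -
        (2 : ℤ) ^ (bsize blk k) * (zcount blk k (pts Y p.1) : ℤ)) =
      (p.2 : ℤ) * (∑ y ∈ pts Y p.1, G y) - (p.2 : ℤ) * (((pts Y p.1).card : ℤ) *
        ((Module.finrank (ZMod 2) p.1.direction : ℤ) - (sdim blk k M' h p.1 : ℤ))) := by
    intro p _
    rw [hsumG]
    ring
  rw [List.map_congr_left hper, ClusCoordBook.list_sum_map_sub, cover_sum Y C q hcov G, hsumG Y] at hFC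
  have hdsum : ∑ y ∈ Y, ((M : ℤ) - (acodim M Y y : ℤ)) = dsum M Y := rfl
  rw [hdsum] at hFC
  nlinarith [hmem, hFC]

end Summit.PneNP.PneNP.Theorems.ClusCoordFlatCover
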